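import Summits.CriticalPhenomena.CardyFormulaZ2.Theorems.CardyTensorRGPolyominoGaussianLawStubDilationEquicontinuityPart3

/-!
# Stub `stub_dilationEquicontinuity` of the birth skeleton of the crux `PolyominoGaussianLaw`
# (stmt-CriticalPhenomena-14337, route `CardyTensorRG`) — Part 4: a crossing of the narrower
# quad is a discrete crossing

Lower half of the sandwich (`dl_cross_subset_discreteCrossing`). `Ω = Ψ((-1,1)²)` a framed domain,
`A = Ψ`(bottom), `B = Ψ`(top), `0 < α < 1`; at mesh `δ` assume (modulus) points of `Ψ([-1,1]²)` within
`8δ` have model points within `(1 - α)/4`, (bonds) no lattice bond with both ends in `Ω` leaves `Ω`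
(Part 1), (bulk) the fine sites of `Ψ([-(1+α)/2, (1+α)/2] × [-1/2, 1/2])` lie in `meshDomain Ω δ`.
Then every configuration crossing the NARROWER quad `Ψ([-α, α] × [-1, 1])` inside its drawn open
edges lies in `discreteCrossing Ω δ A B`. Proof (Schramm–Smirnov 2011, §1.3, made quantitative at
the boundary): the open bonds drawn through the crossing `K` are chained by an open lattice path
through their ends (`openConnIn_of_isPreconnected_subset_openEdgeUnion`) from an end off `Ω` of the
bond through `K ∩ A` to an end off `Ω` of the bond through `K ∩ B`; every site of it is within `δ` of
`K`, so a site off `Ω` is near `A` or near `B`, never both, and `A`-near / `B`-near sites are not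
adjacent (Part 3). With `j` the first site off `Ω` near `B` and `i` the last site off `Ω` before it
(near `A`), the sites strictly between form a nonempty run in `Ω` joined by open bonds inside `Ω`;
the model height moves by `< (1-α)/4` per step from `< -3/4` to `> 3/4`, so some site of the run is
in the bulk box, hence in `meshDomain Ω δ`, and so is the whole run; its two ends are
discrete-boundary vertices at `infDist < 3δ` from `A` / `B` and `≥ 3δ` from the rest of the
frontier, i.e. on the discrete arcs. All [folklore].
-/

noncomputable section

open Set Metric Complex
open scoped unitInterval
open Literature.Probability.LatticeModels Literature.Probability.Percolation
open Literature.Probability.Percolation.QuadCrossing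

namespace Summit.CriticalPhenomena.CardyFormulaZ2.Cruxes.PolyominoGaussianLaw.Birth

/-- **A crossing of the narrower quad inside the open edges is a discrete crossing.** See the
module docstring. [folklore] -/
theorem dl_cross_subset_discreteCrossing (Ψ sc : ℂ ≃ₜ ℂ) {α δ : ℝ} (hα0 : 0 < α) (hα1 : α < 1)
    (hsc : ∀ z : ℂ, sc z = ⟨α * z.re, 1 * z.im⟩) (hδ : 0 < δ)
    (hη : ∀ z ∈ Ψ '' (Icc (-1 : ℝ) 1 ×ℂ Icc (-1 : ℝ) 1), ∀ z' ∈ Ψ '' (Icc (-1 : ℝ) 1 ×ℂ Icc (-1 : ℝ) 1),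
      dist z z' < 8 * δ → dist (Ψ.symm z) (Ψ.symm z') < (1 - α) / 4)
    (hD2 : ∀ x y : Site 2, (zdGraph 2).Adj x y →
      meshPoint δ x ∈ Ψ '' (Ioo (-1 : ℝ) 1 ×ℂ Ioo (-1 : ℝ) 1) →
      meshPoint δ y ∈ Ψ '' (Ioo (-1 : ℝ) 1 ×ℂ Ioo (-1 : ℝ) 1) →
      segment ℝ (meshPoint δ x) (meshPoint δ y) ⊆ Ψ '' (Ioo (-1 : ℝ) 1 ×ℂ Ioo (-1 : ℝ) 1))
    (hbulk : ∀ x : Site 2, meshPoint δ x ∈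
        Ψ '' (Icc (-((1 + α) / 2)) ((1 + α) / 2) ×ℂ Icc (-(1 / 2 : ℝ)) (1 / 2)) →
      x ∈ meshDomain (Ψ '' (Ioo (-1 : ℝ) 1 ×ℂ Ioo (-1 : ℝ) 1)) δ) :
    {ω | ∃ K, (squareModelQuad (sc.trans Ψ)).IsCrossing K ∧ K ⊆ openEdgeUnion δ ω} ⊆
      discreteCrossing (Ψ '' (Ioo (-1 : ℝ) 1 ×ℂ Ioo (-1 : ℝ) 1)) δ
        (Ψ '' {p : ℂ | p.im = -1 ∧ p.re ∈ Icc (-1 : ℝ) 1})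
        (Ψ '' {p : ℂ | p.im = 1 ∧ p.re ∈ Icc (-1 : ℝ) 1}) := by
  classical
  rintro ω ⟨K, ⟨hKc, hKconn, hKsub, ⟨q₀, hq₀K, hq₀s⟩, ⟨q₂, hq₂K, hq₂s⟩⟩, hKO⟩
  set Ω : Set ℂ := Ψ '' (Ioo (-1 : ℝ) 1 ×ℂ Ioo (-1 : ℝ) 1) with hΩ
  set A : Set ℂ := Ψ '' {p : ℂ | p.im = -1 ∧ p.re ∈ Icc (-1 : ℝ) 1} with hA
  set B : Set ℂ := Ψ '' {p : ℂ | p.im = 1 ∧ p.re ∈ Icc (-1 : ℝ) 1} with hB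
  set Sq : Set ℂ := Icc (-1 : ℝ) 1 ×ℂ Icc (-1 : ℝ) 1 with hSq
  have hΩo : IsOpen Ω := dl_isOpen_framed Ψ
  set w : ℝ := 1 - α with hw
  have hw0 : 0 < w := by linarith
  have hw1 : w < 1 := by linarith
  have hκ : w / 4 ≤ 1 - α := by linarith
  rw [dl_carrier_squareModelQuad_scale hsc hα0 one_pos Ψ] at hKsub
  rw [dl_side_zero_squareModelQuad_scale hsc hα0 Ψ] at hq₀s
  rw [dl_side_two_squareModelQuad_scale hsc hα0 Ψ] at hq₂s
  have hKS : K ⊆ Ψ '' Sq := hKsub.trans (image_mono fun p hp =>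
    ⟨⟨by linarith [hp.1.1], by linarith [hp.1.2]⟩, hp.2⟩)
  have hKre : ∀ k ∈ K, |(Ψ.symm k).re| ≤ α := fun k hk => by
    obtain ⟨p, hp, rfl⟩ := hKsub hk
    rw [Ψ.symm_apply_apply]
    exact abs_le.2 ⟨hp.1.1, hp.1.2⟩
  have hq₀A : q₀ ∈ A := by
    obtain ⟨p, ⟨h1, h2, h3⟩, rfl⟩ := hq₀s
    exact ⟨p, ⟨h1, by linarith, by linarith⟩, rfl⟩
  have hq₂B : q₂ ∈ B := by
    obtain ⟨p, ⟨h1, h2, h3⟩, rfl⟩ := hq₂s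
    exact ⟨p, ⟨h1, by linarith, by linarith⟩, rfl⟩
  have hAfr : A ⊆ frontier Ω := by
    rw [hΩ, dl_frontier_framed]; exact image_mono dl_bot_subset_frontier
  have hBfr : B ⊆ frontier Ω := by
    rw [hΩ, dl_frontier_framed]; exact image_mono dl_top_subset_frontier
  have hΩS : Ω ⊆ Ψ '' Sq := dl_framed_subset_image_Sq Ψ
  have hAne : A.Nonempty := ⟨q₀, hq₀A⟩
  have hBne : B.Nonempty := ⟨q₂, hq₂B⟩
  have hfrΩ : ∀ z ∈ frontier Ω, z ∉ Ω := fun z hz hzΩ => by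
    have h : z ∈ Ω ∩ frontier Ω := ⟨hzΩ, hz⟩
    rw [hΩo.inter_frontier_eq] at h
    exact h
  set ω₁ : BondConfig (Site 2) := ω ∩ (zdGraph 2).edgeSet with hω₁
  have hω₁E : ω₁ ⊆ (zdGraph 2).edgeSet := inter_subset_right
  have hKO₁ : K ⊆ openEdgeUnion δ ω₁ := by rw [hω₁, dl_openEdgeUnion_inter_edgeSet]; exact hKO
  set E := edgePairs δ ω₁ K with hE
  set S : Set (Site 2) := {v | ∃ p ∈ E, p.1 = v} with hSdef
  have hS : ∀ p ∈ E, p.1 ∈ S := fun p hp => ⟨p, hp, rfl⟩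
  have hnear : ∀ v ∈ S, ∃ k ∈ K, dist (meshPoint δ v) k ≤ δ := by
    rintro v ⟨p, ⟨hadj, -, k, hkseg, hkK⟩, rfl⟩
    refine ⟨k, hkK, ?_⟩
    rw [dist_comm, dist_eq_norm]
    calc ‖k - meshPoint δ p.1‖ ≤ ‖meshPoint δ p.2 - meshPoint δ p.1‖ := norm_sub_le_of_mem_segment hkseg
      _ = dist (meshPoint δ p.2) (meshPoint δ p.1) := (dist_eq_norm _ _).symm
      _ ≤ δ := Polyomino.dist_meshPoint_le_of_adj hδ.le hadj.symm
  -- sites off `Ω` are near `A` or near `B`; sites in `Ω` have small model abscissa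
  have hlabel : ∀ v ∈ S, meshPoint δ v ∉ Ω →
      infDist (meshPoint δ v) A ≤ δ ∨ infDist (meshPoint δ v) B ≤ δ := fun v hv hvΩ => by
    obtain ⟨k, hkK, hvk⟩ := hnear v hv
    exact dl_near_arcs_of_not_mem Ψ hκ hη (by linarith : δ < 8 * δ) (hKS hkK) (hKre k hkK) hvk hvΩ
  have hSre : ∀ v ∈ S, meshPoint δ v ∈ Ω → |(Ψ.symm (meshPoint δ v)).re| < α + w / 4 :=
    fun v hv hvΩ => by
    obtain ⟨k, hkK, hvk⟩ := hnear v hv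
    have hd := hη _ (hΩS hvΩ) _ (hKS hkK) (hvk.trans_lt (by linarith))
    have h1 := (abs_re_sub_le_dist_chart (Ψ.symm (meshPoint δ v)) (Ψ.symm k)).trans_lt hd
    have h2 := hKre k hkK
    have h3 := abs_sub_abs_le_abs_sub (Ψ.symm (meshPoint δ v)).re (Ψ.symm k).re
    linarith
  have hexcl : ∀ u v : ℂ, infDist u A ≤ δ → infDist v B ≤ δ → δ < dist u v := fun u v hu hv =>
    dl_not_near_both Ψ hκ hα0 hη hδ (by linarith) hu hv
  -- ends of the chain: off `Ω`, within `δ` of the contact points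
  have horient : ∀ p ∈ E, ∀ q ∈ segment ℝ (meshPoint δ p.1) (meshPoint δ p.2), q ∉ Ω →
      ∃ p' ∈ E, meshPoint δ p'.1 ∉ Ω ∧ dist (meshPoint δ p'.1) q ≤ δ := by
    intro p hp q hq hqΩ
    have hlen : dist (meshPoint δ p.1) (meshPoint δ p.2) ≤ δ :=
      Polyomino.dist_meshPoint_le_of_adj hδ.le hp.1
    have hd1 : dist (meshPoint δ p.1) q ≤ δ := by
      rw [dist_comm, dist_eq_norm]
      exact (norm_sub_le_of_mem_segment hq).trans (by rwa [← dist_eq_norm, dist_comm])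
    have hd2 : dist (meshPoint δ p.2) q ≤ δ := by
      rw [segment_symm] at hq
      rw [dist_comm, dist_eq_norm]
      exact (norm_sub_le_of_mem_segment hq).trans (by rwa [← dist_eq_norm])
    by_cases h1 : meshPoint δ p.1 ∈ Ω
    · by_cases h2 : meshPoint δ p.2 ∈ Ω
      · rw [segment_symm] at hq
        exact absurd (hD2 _ _ hp.1 h1 h2 (by rwa [segment_symm])) hqΩ
      · exact ⟨p.swap, swap_mem_edgePairs hp, h2, hd2⟩
    · exact ⟨p, hp, h1, hd1⟩
  obtain ⟨p₀, hp₀E, hq₀seg⟩ := exists_mem_edgePairs_of_mem hKO₁ hq₀K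
  obtain ⟨p₂, hp₂E, hq₂seg⟩ := exists_mem_edgePairs_of_mem hKO₁ hq₂K
  obtain ⟨a₀, ha₀E, ha₀Ω, ha₀d⟩ := horient p₀ hp₀E q₀ hq₀seg (hfrΩ q₀ (hAfr hq₀A))
  obtain ⟨a₂, ha₂E, ha₂Ω, ha₂d⟩ := horient p₂ hp₂E q₂ hq₂seg (hfrΩ q₂ (hBfr hq₂B))
  -- the open lattice walk through the ends of the drawn bonds
  have hconn : ω₁ ∈ openConnIn S a₀.1 a₂.1 :=
    openConnIn_of_isPreconnected_subset_openEdgeUnion hδ hKc hKconn.isPreconnected hKO₁ hS ha₀E ha₂E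
  obtain ⟨W₀, hWS, hWω⟩ := exists_walk_of_mem_openConnIn hω₁E hconn
  have hWH : ∀ e ∈ W₀.edges, e ∈ (zdGraph 2 ⊓ openGraph ω₁).edgeSet := fun e he => by
    rw [SimpleGraph.edgeSet_inf]
    refine ⟨W₀.edges_subset_edgeSet he, ?_⟩
    rw [openGraph, SimpleGraph.edgeSet_fromEdgeSet]
    exact ⟨hWω e he, SimpleGraph.not_isDiag_of_mem_edgeSet _ (W₀.edges_subset_edgeSet he)⟩
  set W := W₀.transfer (zdGraph 2 ⊓ openGraph ω₁) hWH with hW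
  set g : ℕ → Site 2 := W.getVert with hg
  set n : ℕ := W.length with hn
  have hgS : ∀ i, g i ∈ S := fun i => by
    have h := W.getVert_mem_support i
    rw [hW, SimpleGraph.Walk.support_transfer] at h
    exact hWS _ h
  have hgadj : ∀ i, i < n → (zdGraph 2).Adj (g i) (g (i + 1)) := fun i hi => (W.adj_getVert_succ hi).1
  have hgω : ∀ i, i < n → s(g i, g (i + 1)) ∈ ω := fun i hi =>
    ((openGraph_adj ω₁ _ _).1 (W.adj_getVert_succ hi).2).1.1
  have hgdist : ∀ i, i < n → dist (meshPoint δ (g i)) (meshPoint δ (g (i + 1))) ≤ δ := fun i hi =>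
    Polyomino.dist_meshPoint_le_of_adj hδ.le (hgadj i hi)
  have hg0 : g 0 = a₀.1 := W.getVert_zero
  have hgn : g n = a₂.1 := W.getVert_length
  have hPA0 : infDist (meshPoint δ (g 0)) A ≤ δ := by
    rw [hg0]; exact (infDist_le_dist_of_mem hq₀A).trans ha₀d
  have hPBn : infDist (meshPoint δ (g n)) B ≤ δ := by
    rw [hgn]; exact (infDist_le_dist_of_mem hq₂B).trans ha₂d
  have hg0Ω : meshPoint δ (g 0) ∉ Ω := by rw [hg0]; exact ha₀Ω
  have hgnΩ : meshPoint δ (g n) ∉ Ω := by rw [hgn]; exact ha₂Ω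
  -- `j`: the first site off `Ω` near `B`
  have hexj : ∃ j, j ≤ n ∧ meshPoint δ (g j) ∉ Ω ∧ infDist (meshPoint δ (g j)) B ≤ δ :=
    ⟨n, le_rfl, hgnΩ, hPBn⟩
  obtain ⟨hjn, hgjΩ, hPBj⟩ := Nat.find_spec hexj
  set j : ℕ := Nat.find hexj with hj
  have hjmin : ∀ l, l < j → meshPoint δ (g l) ∉ Ω → ¬ infDist (meshPoint δ (g l)) B ≤ δ :=
    fun l hl hlΩ hlB => Nat.find_min hexj hl ⟨hl.le.trans hjn, hlΩ, hlB⟩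
  have hj0 : 0 < j := by
    rw [Nat.pos_iff_ne_zero]
    intro h0
    have h := hPBj
    rw [h0] at h
    have := hexcl _ _ hPA0 h
    rw [dist_self] at this
    linarith
  -- `i`: the last site before `j` off `Ω`
  set i : ℕ := Nat.findGreatest (fun i => meshPoint δ (g i) ∉ Ω) (j - 1) with hi
  have hiP : meshPoint δ (g i) ∉ Ω :=
    Nat.findGreatest_spec (P := fun i => meshPoint δ (g i) ∉ Ω) (Nat.zero_le _) hg0Ω
  have hij : i ≤ j - 1 := Nat.findGreatest_le _
  have hij' : i < j := by omega
  have himax : ∀ k, i < k → k ≤ j - 1 → meshPoint δ (g k) ∈ Ω := fun k hk hkj => by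
    have := Nat.findGreatest_is_greatest (P := fun i => meshPoint δ (g i) ∉ Ω) hk hkj
    simpa using this
  have hPAi : infDist (meshPoint δ (g i)) A ≤ δ := by
    rcases hlabel (g i) (hgS i) hiP with h | h
    · exact h
    · exact absurd h (hjmin i hij' hiP)
  -- the run `i+1, …, j-1` is nonempty and lies in `Ω`
  have hrun : i + 2 ≤ j := by
    by_contra h
    have hji : j = i + 1 := by omega
    have h1 := hgdist i (by omega)
    rw [← hji] at h1
    have h2 := hexcl _ _ hPAi hPBj
    linarith
  have hrunΩ : ∀ k, i + 1 ≤ k → k ≤ j - 1 → meshPoint δ (g k) ∈ Ω := fun k hk1 hk2 =>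
    himax k (by omega) hk2
  set F : ℕ → ℝ := fun k => (Ψ.symm (meshPoint δ (g k))).im with hF
  have hstep : ∀ k, i + 1 ≤ k → k + 1 ≤ j - 1 → |F (k + 1) - F k| < w / 4 := fun k hk1 hk2 => by
    have h1 := hrunΩ k hk1 (by omega)
    have h2 := hrunΩ (k + 1) (by omega) hk2
    have hd : dist (meshPoint δ (g (k + 1))) (meshPoint δ (g k)) < 8 * δ := by
      rw [dist_comm]; exact (hgdist k (by omega)).trans_lt (by linarith)
    exact (abs_im_sub_le_dist_chart _ _).trans_lt (hη _ (hΩS h2) _ (hΩS h1) hd)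
  have hFstart : F (i + 1) < -1 + w / 4 := by
    obtain ⟨a, ha, hda⟩ := (infDist_lt_iff hAne).1 (hPAi.trans_lt (by linarith : δ < 2 * δ))
    have hd : dist (meshPoint δ (g (i + 1))) a < 8 * δ := by
      have h0 : dist (meshPoint δ (g (i + 1))) (meshPoint δ (g i)) ≤ δ := by
        rw [dist_comm]; exact hgdist i (by omega)
      have := dist_triangle (meshPoint δ (g (i + 1))) (meshPoint δ (g i)) a
      linarith
    have h1 := hη _ (hΩS (hrunΩ (i + 1) le_rfl (by omega))) _ (image_mono dl_bot_subset_Sq ha) hd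
    have haim : (Ψ.symm a).im = -1 := (dl_symm_mem_of_mem_image Ψ ha).1
    have h2 := abs_im_sub_le_dist_chart (Ψ.symm (meshPoint δ (g (i + 1)))) (Ψ.symm a)
    rw [haim] at h2
    have h3 := h2.trans_lt h1
    rw [abs_lt] at h3
    show (Ψ.symm (meshPoint δ (g (i + 1)))).im < -1 + w / 4
    linarith [h3.2]
  have hFend : 1 - w / 4 < F (j - 1) := by
    obtain ⟨b, hb, hdb⟩ := (infDist_lt_iff hBne).1 (hPBj.trans_lt (by linarith : δ < 2 * δ))
    have hd : dist (meshPoint δ (g (j - 1))) b < 8 * δ := by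
      have h1 := hgdist (j - 1) (by omega)
      rw [show j - 1 + 1 = j by omega] at h1
      have := dist_triangle (meshPoint δ (g (j - 1))) (meshPoint δ (g j)) b
      linarith
    have h1 := hη _ (hΩS (hrunΩ (j - 1) (by omega) le_rfl)) _ (image_mono dl_top_subset_Sq hb) hd
    have hbim : (Ψ.symm b).im = 1 := (dl_symm_mem_of_mem_image Ψ hb).1
    have h2 := abs_im_sub_le_dist_chart (Ψ.symm (meshPoint δ (g (j - 1)))) (Ψ.symm b)
    rw [hbim] at h2
    have h3 := h2.trans_lt h1
    rw [abs_lt] at h3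
    show 1 - w / 4 < (Ψ.symm (meshPoint δ (g (j - 1)))).im
    linarith [h3.1]
  -- `m`: the first site of the run with nonnegative model height; it is in the bulk box
  have hexm : ∃ m, i + 1 ≤ m ∧ m ≤ j - 1 ∧ 0 ≤ F m := ⟨j - 1, by omega, le_rfl, by linarith⟩
  obtain ⟨hm1, hm2, hFm⟩ := Nat.find_spec hexm
  set m : ℕ := Nat.find hexm with hm
  have hmne : m ≠ i + 1 := fun h => by
    have h' := hFm
    rw [h] at h'
    linarith
  have hFm1 : F (m - 1) < 0 := by
    by_contra h
    push Not at h
    exact Nat.find_min hexm (show m - 1 < m by omega) ⟨by omega, by omega, h⟩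
  have hFm' : F m < w / 4 := by
    have h := hstep (m - 1) (by omega) (by omega)
    rw [show m - 1 + 1 = m by omega, abs_lt] at h
    linarith [h.2]
  have hgmΩ : meshPoint δ (g m) ∈ Ω := hrunΩ m hm1 hm2
  have hgmD : g m ∈ meshDomain Ω δ := by
    refine hbulk _ ⟨Ψ.symm (meshPoint δ (g m)), ⟨⟨?_, ?_⟩, ⟨?_, ?_⟩⟩, Ψ.apply_symm_apply _⟩
    · have := (abs_lt.1 (hSre _ (hgS m) hgmΩ)).1
      show -((1 + α) / 2) ≤ (Ψ.symm (meshPoint δ (g m))).re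
      linarith
    · have := (abs_lt.1 (hSre _ (hgS m) hgmΩ)).2
      show (Ψ.symm (meshPoint δ (g m))).re ≤ (1 + α) / 2
      linarith
    · show -(1 / 2 : ℝ) ≤ (Ψ.symm (meshPoint δ (g m))).im
      have : (0 : ℝ) ≤ F m := hFm
      simp only [hF] at this
      linarith
    · show (Ψ.symm (meshPoint δ (g m))).im ≤ 1 / 2
      have : F m < w / 4 := hFm'
      simp only [hF] at this
      linarith
  -- the whole run lies in the largest mesh component
  have hmeshAdj : ∀ k, i + 1 ≤ k → k + 1 ≤ j - 1 → (meshGraph Ω δ).Adj (g k) (g (k + 1)) :=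
    fun k hk1 hk2 => meshGraph_adj_iff.2 ⟨hgadj k (by omega),
      (hD2 _ _ (hgadj k (by omega)) (hrunΩ k hk1 (by omega)) (hrunΩ (k + 1) (by omega) hk2)).trans
        subset_closure⟩
  have hup : ∀ d, m + d ≤ j - 1 → g (m + d) ∈ meshDomain Ω δ := by
    intro d
    induction d with
    | zero => intro _; simpa using hgmD
    | succ d ih =>
      intro hd
      have h1 := ih (by omega)
      rw [← add_assoc]
      exact Summit.CriticalPhenomena.CardyFormulaZ2.Theorems.KirchhoffSlope.mem_meshDomain_of_meshGraph_adj h1 (hrunΩ (m + d + 1) (by omega) (by omega))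
        (hmeshAdj (m + d) (by omega) (by omega))
  have hdown : ∀ d, d + (i + 1) ≤ m → g (m - d) ∈ meshDomain Ω δ := by
    intro d
    induction d with
    | zero => intro _; simpa using hgmD
    | succ d ih =>
      intro hd
      have h1 := ih (by omega)
      have hadj := hmeshAdj (m - (d + 1)) (by omega) (by omega)
      rw [show m - (d + 1) + 1 = m - d by omega] at hadj
      exact Summit.CriticalPhenomena.CardyFormulaZ2.Theorems.KirchhoffSlope.mem_meshDomain_of_meshGraph_adj h1 (hrunΩ (m - (d + 1)) (by omega) (by omega)) hadj.symm
  have hrunD : ∀ k, i + 1 ≤ k → k ≤ j - 1 → g k ∈ meshDomain Ω δ := fun k hk1 hk2 => by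
    by_cases hkm : m ≤ k
    · have := hup (k - m) (by omega)
      rwa [show m + (k - m) = k by omega] at this
    · have := hdown (m - k) (by omega)
      rwa [show m - (m - k) = k by omega] at this
  -- open `Ω_δ`-path along the run
  have hreach : ∀ d, i + 1 + d ≤ j - 1 →
      (openGraph ω ⊓ discreteDomainGraph Ω δ).Reachable (g (i + 1)) (g (i + 1 + d)) := by
    intro d
    induction d with
    | zero => intro _; rfl
    | succ d ih =>
      intro hd
      refine (ih (by omega)).trans (SimpleGraph.Adj.reachable ?_)
      rw [← add_assoc]
      refine ⟨(openGraph_adj ω _ _).2 ⟨hgω (i + 1 + d) (by omega), (hgadj (i + 1 + d) (by omega)).ne⟩,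
        discreteDomainGraph_adj_iff.2 ⟨hmeshAdj (i + 1 + d) (by omega) (by omega),
          hrunD (i + 1 + d) (by omega) (by omega), hrunD (i + 1 + d + 1) (by omega) hd⟩⟩
  -- the two ends of the run lie on the discrete arcs
  have hnotD : ∀ k, meshPoint δ (g k) ∉ Ω → g k ∉ meshDomain Ω δ := fun k hk hkD =>
    hk (meshDomain_subset_meshVertices _ _ hkD)
  have hxB : g (i + 1) ∈ meshBoundary Ω δ :=
    mem_meshBoundary_of_adj_not_mem (hrunD (i + 1) le_rfl (by omega)) (hgadj i (by omega)).symm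
      (hnotD i hiP)
  have hyB : g (j - 1) ∈ meshBoundary Ω δ := by
    have hadj := hgadj (j - 1) (by omega)
    rw [show j - 1 + 1 = j by omega] at hadj
    exact mem_meshBoundary_of_adj_not_mem (hrunD (j - 1) (by omega) le_rfl) hadj (hnotD j hgjΩ)
  -- distances of the ends to the arcs
  obtain ⟨a, ha, hda⟩ := (infDist_lt_iff hAne).1 (hPAi.trans_lt (by linarith : δ < 2 * δ))
  have hxa : dist (meshPoint δ (g (i + 1))) a < 3 * δ := by
    have h0 : dist (meshPoint δ (g (i + 1))) (meshPoint δ (g i)) ≤ δ := by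
      rw [dist_comm]; exact hgdist i (by omega)
    have := dist_triangle (meshPoint δ (g (i + 1))) (meshPoint δ (g i)) a
    linarith
  obtain ⟨b, hb, hdb⟩ := (infDist_lt_iff hBne).1 (hPBj.trans_lt (by linarith : δ < 2 * δ))
  have hyb : dist (meshPoint δ (g (j - 1))) b < 3 * δ := by
    have h1 := hgdist (j - 1) (by omega)
    rw [show j - 1 + 1 = j by omega] at h1
    have := dist_triangle (meshPoint δ (g (j - 1))) (meshPoint δ (g j)) b
    linarith
  have hfar : ∀ v ∈ S, meshPoint δ v ∈ Ω → ∀ c ∈ frontier Ω, dist (meshPoint δ v) c < 3 * δ →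
      c ∈ A ∨ c ∈ B := fun v hv hvΩ c hc hdc => by
    obtain ⟨k, hkK, hvk⟩ := hnear v hv
    have hck : dist c k < 8 * δ := by
      have := dist_triangle c (meshPoint δ v) k
      rw [dist_comm c (meshPoint δ v)] at this
      linarith
    exact dl_mem_arcs_of_frontier_near Ψ hκ hη hc (hKS hkK) (hKre k hkK) hck
  have hq₂A : q₂ ∉ A := fun h => by
    have := hexcl q₂ q₂ (by rw [infDist_zero_of_mem h]; exact hδ.le)
      (by rw [infDist_zero_of_mem hq₂B]; exact hδ.le)
    rw [dist_self] at this
    linarith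
  have hq₀B : q₀ ∉ B := fun h => by
    have := hexcl q₀ q₀ (by rw [infDist_zero_of_mem hq₀A]; exact hδ.le)
      (by rw [infDist_zero_of_mem h]; exact hδ.le)
    rw [dist_self] at this
    linarith
  have hxarc : g (i + 1) ∈ discreteArc Ω δ A := by
    refine ⟨hxB, ((infDist_le_dist_of_mem ha).trans hxa.le).trans ?_⟩
    have hne' : (frontier Ω \ A).Nonempty := ⟨q₂, hBfr hq₂B, hq₂A⟩
    refine (le_infDist hne').2 fun c hc => ?_
    · by_contra hlt
      push Not at hlt
      rcases hfar _ (hgS (i + 1)) (hrunΩ (i + 1) le_rfl (by omega)) c hc.1 hlt with h | h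
      · exact hc.2 h
      · have h8 := dl_dist_arcs_ge Ψ hκ hα0 hη ha h
        have := dist_triangle a (meshPoint δ (g (i + 1))) c
        rw [dist_comm a (meshPoint δ (g (i + 1)))] at this
        linarith
  have hyarc : g (j - 1) ∈ discreteArc Ω δ B := by
    refine ⟨hyB, ((infDist_le_dist_of_mem hb).trans hyb.le).trans ?_⟩
    have hne' : (frontier Ω \ B).Nonempty := ⟨q₀, hAfr hq₀A, hq₀B⟩
    refine (le_infDist hne').2 fun c hc => ?_
    · by_contra hlt
      push Not at hlt
      rcases hfar _ (hgS (j - 1)) (hrunΩ (j - 1) (by omega) le_rfl) c hc.1 hlt with h | h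
      · have h8 := dl_dist_arcs_ge Ψ hκ hα0 hη h hb
        have := dist_triangle c (meshPoint δ (g (j - 1))) b
        rw [dist_comm c (meshPoint δ (g (j - 1)))] at this
        linarith
      · exact hc.2 h
  have hfin := hreach (j - 1 - (i + 1)) (by omega)
  rw [show i + 1 + (j - 1 - (i + 1)) = j - 1 by omega] at hfin
  exact ⟨g (i + 1), hxarc, g (j - 1), hyarc, hfin⟩

/-! ### Registered one-line form -/

/-- **Registered sub-goal `stub_dilationEquicontinuity_part4`** of `stub_dilationEquicontinuity`
(stmt-CriticalPhenomena-14337): the lower half of the sandwich, one-line form of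
`dl_cross_subset_discreteCrossing`. [folklore] -/
theorem stub_dilationEquicontinuity_part4 : ∀ (Ψ sc : ℂ ≃ₜ ℂ) (α δ : ℝ), 0 < α → α < 1 → (∀ z : ℂ, sc z = ⟨α * z.re, 1 * z.im⟩) → 0 < δ → (∀ z ∈ Ψ '' (Set.Icc (-1 : ℝ) 1 ×ℂ Set.Icc (-1 : ℝ) 1), ∀ z' ∈ Ψ '' (Set.Icc (-1 : ℝ) 1 ×ℂ Set.Icc (-1 : ℝ) 1), dist z z' < 8 * δ → dist (Ψ.symm z) (Ψ.symm z') < (1 - α) / 4) → (∀ x y : Literature.Probability.LatticeModels.Site 2, (Literature.Probability.LatticeModels.zdGraph 2).Adj x y → Literature.Probability.LatticeModels.meshPoint δ x ∈ Ψ '' (Set.Ioo (-1 : ℝ) 1 ×ℂ Set.Ioo (-1 : ℝ) 1) → Literature.Probability.LatticeModels.meshPoint δ y ∈ Ψ '' (Set.Ioo (-1 : ℝ) 1 ×ℂ Set.Ioo (-1 : ℝ) 1) → segment ℝ (Literature.Probability.LatticeModels.meshPoint δ x) (Literature.Probability.LatticeModels.meshPoint δ y) ⊆ Ψ '' (Set.Ioo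 (-1 : ℝ) 1 ×ℂ Set.Ioo (-1 : ℝ) 1)) → (∀ x : Literature.Probability.LatticeModels.Site 2, Literature.Probability.LatticeModels.meshPoint δ x ∈ Ψ '' (Set.Icc (-((1 + α) / 2)) ((1 + α) / 2) ×ℂ Set.Icc (-(1 / 2 : ℝ)) (1 / 2)) → x ∈ Literature.Probability.LatticeModels.meshDomain (Ψ '' (Set.Ioo (-1 : ℝ) 1 ×ℂ Set.Ioo (-1 : ℝ) 1)) δ) → {ω | ∃ K, (Literature.Probability.Percolation.squareModelQuad (sc.trans Ψ)).IsCrossing K ∧ K ⊆ Literature.Probability.Percolation.openEdgeUnion δ ω} ⊆ Literature.Probability.Percolation.discreteCrossing (Ψ '' (Set.Ioo (-1 : ℝ) 1 ×ℂ Set.Ioo (-1 : ℝ) 1)) δ (Ψ '' {p : ℂ | p.im = -1 ∧ p.re ∈ Set.Icc (-1 : ℝ) 1}) (Ψ '' {p : ℂ | p.im = 1 ∧ p.re ∈ Set.Icc (-1 : ℝ) 1}) :=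
  fun Ψ sc _ _ hα0 hα1 hsc hδ hη hD2 hbulk => dl_cross_subset_discreteCrossing Ψ sc hα0 hα1 hsc hδ hη hD2 hbulk

end Summit.CriticalPhenomena.CardyFormulaZ2.Cruxes.PolyominoGaussianLaw.Birth
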